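import Summits.CriticalPhenomena.PercolationContinuityZ3.Theorems.PercNearOneGluingNoHeavyLowerTailSunflowerMultiPetalCompleting
import Summits.CriticalPhenomena.PercolationContinuityZ3.Theorems.PercNearOneGluingNoHeavyLowerTailSunflowerMultiPetalPendant
import HarnessLib
import HarnessLib.Audit

/-!
# `NoHeavyLowerTail` (crux stmt-CriticalPhenomena-4575), abstract sunflower cubic, `k` petals: the BOTTOM-SPECTATOR FUNCTIONAL
# `Q = 3·(bottom-spectator Gladkov slack) − (rainbows)`, its TERMWISE one-point monotonicity, and ★ₖ / "Lemma B" under a mixed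
# elimination order (inert · pendant · non-bottom singleton · petal-completing coordinates)

Support file (seat `prim-l12-p2` gen 36; `--supports stmt-CriticalPhenomena-4575`; companion of `…SunflowerMultiPetalSpectator` (p339016:
`kkK`, `triK`, `decK`, `SwK`, `NtriK`, `ZK_eq_spec`, charts), `…SunflowerMultiPetalCompleting` (p340984: `chart3_eq_iff_petal`,
`ZK_nonneg_of_petalCompleting`), `…SunflowerMultiPetalUpperOnePetal` (p341252: `chart4`), `…SunflowerMultiPetalSingleton` (p343107),
`…SunflowerMultiPetalRestriction` (p340634: `ZKW`) and `…SunflowerMultiPetalPendant` (p377883)).  No `sorry`; nothing is asserted about the crux.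
Memo: run/shared/lean/prim/prim-l12/prim-l12-p2/FINDING-g36-BOTTOM-SPECTATOR.md.

THE FUNCTIONAL.  By the spectator form (`ZK_eq_spec`) `ZK = 3·SwK [decided] − NtriK`; split the decided spectators into bottom and top
ones: `ZK = (3·SwK [bottom] − NtriK) + 3·SwK [top]`.  The second summand is a nonnegative combination of antipodal Gladkov sums, so
  `QK := 3·SwK [bottom] − NtriK ≤ ZK`                                                    (`three_SwK_botK_sub_NtriK_le_ZK`),
and `0 ≤ QK` ("LEMMA B": the rainbows are paid by the BOTTOM spectators' slack alone) implies ★ₖ.  Lemma B is FALSE for general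
structures (non-injectively coloured ones: the doubled star of gen 5, `…SunflowerDoubledStar`), so no conjecture is filed here;
for the injectively coloured clutters of GRAPHS it holds in every case computed (all graphs on ≤ 9 vertices, exhaustive; memo §2).
Pointwise, `QK = Σ_{(X,Y,Z)} qK (lab X) (lab Y) (lab Z)` with `qK x y z = [x=0]·kkK y z + [y=0]·kkK x z + [z=0]·kkK x y − triK x y z`
(`= 2` on {top, bottom, bottom}, `= −1` on {bottom, petal, petal'} and on rainbows, `0` otherwise); `QKW W` is its sub-cube version.

WHY `Q` AND NOT `Z`.  The one-point kernel of `Q` is TERMWISE monotone in two situations where the kernel of `Z` is not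
(`uopIneqK` of p341252 needs Gladkov correction terms, `pcIneqK` of p340984 only bounds by `kk`-sums):
* `qcIneqK`: lower/upper codes with `x₀ = 0 ∨ x₁ = ⊤` (PETAL-COMPLETING coordinate: every petal set is completed into the kernel) give
  `qK x₀ y₀ z₀ ≤ qK x₁ y₀ z₀ + qK x₀ y₁ z₀ + qK x₀ y₀ z₁`;
* `usIneqK`: the same under `x₀ ≤ x₁ ∈ {p, ⊤}` for one non-bottom label `p` (coordinate — or offset set — whose own label is not bottom).
The consequences for sub-cubes (one-point monotonicity of `QKW` at petal-completing coordinates and at non-bottom singletons, the inert and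
pendant rules, and `0 ≤ QKW` / Lemma B / ★ₖ under a mixed elimination order — for graph clutters: every induced subgraph has an isolated
vertex, a leaf, a half-edge vertex or a vertex with independent non-neighbourhood) are the companion file `…SunflowerMultiPetalBottomSpectatorOrder`.
This file: the kernel `qK`, its split `s6K = qK + Σ[top]·kkK` (`s6K_eq_qK_add_top`), the two code inequalities, `QKW` with `QKW ≤ ZKW`
(`MSunflower.QKW_le_ZKW`), the whole-cube form `QKW univ = 3·SwK [bottom] − NtriK` (`MSunflower.QKW_univ_eq_spec`) and
`MSunflower.ZK_nonneg_of_lemmaB`.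
-/

namespace Summit.CriticalPhenomena.PercolationContinuityZ3.Theorems.SunflowerPartition

open Finset

/-! ## The bottom / top spectator weights and the kernel `qK` -/

/-- Indicator of the bottom label. [this work] -/
def botK (k : ℕ) (a : Fin (k + 2)) : ℤ := if a = 0 then 1 else 0

/-- Indicator of the top label. [this work] -/
def topK (k : ℕ) (a : Fin (k + 2)) : ℤ := if a = Fin.last (k + 1) then 1 else 0

/-- `botK ≥ 0`. [this work] -/
theorem botK_nonneg (k : ℕ) (a : Fin (k + 2)) : 0 ≤ botK k a := by
  unfold botK; split_ifs <;> norm_num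

/-- `topK ≥ 0`. [this work] -/
theorem topK_nonneg (k : ℕ) (a : Fin (k + 2)) : 0 ≤ topK k a := by
  unfold topK; split_ifs <;> norm_num

/-- Transport of `botK` along a bottom-preserving relabelling. [this work] -/
theorem botK_congr {k k' : ℕ} {a : Fin (k + 2)} {a' : Fin (k' + 2)} (h0 : a = 0 ↔ a' = 0) : botK k a = botK k' a' := by
  unfold botK; exact if_congr h0 rfl rfl

/-- Transport of `topK` along a top-preserving relabelling. [this work] -/
theorem topK_congr {k k' : ℕ} {a : Fin (k + 2)} {a' : Fin (k' + 2)} (ht : a = Fin.last (k + 1) ↔ a' = Fin.last (k' + 1)) :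
    topK k a = topK k' a' := by
  unfold topK; exact if_congr ht rfl rfl

/-- The BOTTOM-SPECTATOR KERNEL `qK x y z = [x=0]·kkK y z + [y=0]·kkK x z + [z=0]·kkK x y − triK x y z`:
`+2` on a top with two bottoms, `−1` on a bottom with two distinct petals and on three distinct petals, `0` otherwise. [this work] -/
def qK (k : ℕ) (x y z : Fin (k + 2)) : ℤ :=
  botK k x * kkK k y z + botK k y * kkK k x z + botK k z * kkK k x y - triK k x y z

/-- Transport of `qK` along a top/bottom/equality-preserving relabelling. [this work] -/
theorem qK_congr {k k' : ℕ} {x y z : Fin (k + 2)} {x' y' z' : Fin (k' + 2)}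
    (hxt : x = Fin.last (k + 1) ↔ x' = Fin.last (k' + 1)) (hx0 : x = 0 ↔ x' = 0)
    (hyt : y = Fin.last (k + 1) ↔ y' = Fin.last (k' + 1)) (hy0 : y = 0 ↔ y' = 0)
    (hzt : z = Fin.last (k + 1) ↔ z' = Fin.last (k' + 1)) (hz0 : z = 0 ↔ z' = 0)
    (hxy : x = y ↔ x' = y') (hyz : y = z ↔ y' = z') (hxz : x = z ↔ x' = z') :
    qK k x y z = qK k' x' y' z' := by
  unfold qK
  rw [botK_congr hx0, botK_congr hy0, botK_congr hz0, kkK_congr hyt hy0 hzt hz0 hyz, kkK_congr hxt hx0 hzt hz0 hxz,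
    kkK_congr hxt hx0 hyt hy0 hxy, triK_congr hxt hx0 hyt hy0 hzt hz0 hxy hyz hxz]

/-- **Pointwise split of the cubic kernel**: `s6K = qK + ([x=⊤]·kkK y z + [y=⊤]·kkK x z + [z=⊤]·kkK x y)` (chart into `Fin 5`). [this work] -/
theorem s6K_eq_qK_add_top (k : ℕ) (x y z : Fin (k + 2)) :
    s6K k x y z = qK k x y z + (topK k x * kkK k y z + topK k y * kkK k x z + topK k z * kkK k x y) := by
  have h5 : ∀ a b c : Fin 5, s6K 3 a b c = qK 3 a b c + (topK 3 a * kkK 3 b c + topK 3 b * kkK 3 a c + topK 3 c * kkK 3 a b) := by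
    decide
  set c := chart3 k x y with hc
  have hxt := (chart3_eq_four_iff k x y x).symm; have hx0 := (chart3_eq_zero_iff k x y x).symm
  have hyt := (chart3_eq_four_iff k x y y).symm; have hy0 := (chart3_eq_zero_iff k x y y).symm
  have hzt := (chart3_eq_four_iff k x y z).symm; have hz0 := (chart3_eq_zero_iff k x y z).symm
  have hxy : x = y ↔ c x = c y := chart3_eq_iff k x y (fun h _ => absurd rfl h.1)
  have hyz : y = z ↔ c y = c z := chart3_eq_iff k x y (fun h _ => absurd rfl h.2)
  have hxz : x = z ↔ c x = c z := chart3_eq_iff k x y (fun h _ => absurd rfl h.1)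
  have e4 : (4 : Fin 5) = Fin.last (3 + 1) := rfl
  rw [e4] at hxt hyt hzt
  rw [s6K_congr hxt hx0 hyt hy0 hzt hz0 hxy hyz hxz, qK_congr hxt hx0 hyt hy0 hzt hz0 hxy hyz hxz,
    topK_congr hxt, topK_congr hyt, topK_congr hzt,
    kkK_congr hyt hy0 hzt hz0 hyz, kkK_congr hxt hx0 hzt hz0 hxz, kkK_congr hxt hx0 hyt hy0 hxy]
  exact h5 _ _ _

/-- `qK` vanishes on the diagonal. [this work] -/
theorem qK_diag (k : ℕ) (a : Fin (k + 2)) : qK k a a a = 0 := by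
  have h5 : ∀ b : Fin 5, qK 3 b b b = 0 := by decide
  have ht := (chart3_eq_four_iff k a a a).symm
  have h0 := (chart3_eq_zero_iff k a a a).symm
  have e4 : (4 : Fin 5) = Fin.last (3 + 1) := rfl
  rw [e4] at ht
  have hee : a = a ↔ chart3 k a a a = chart3 k a a a := ⟨fun _ => rfl, fun _ => rfl⟩
  rw [qK_congr ht h0 ht h0 ht h0 hee hee hee]
  exact h5 _

/-! ## The two termwise one-point inequalities -/

/-- One-point inequality at a PETAL-COMPLETING coordinate, `Fin 5` codes (`decide`): lower labels `x0,y0,z0`, upper labels `x1,y1,z1`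
with `x0 = 0 ∨ x1 = ⊤` etc. [this work] -/
theorem qcIneq5 : ∀ x0 x1 y0 y1 z0 z1 : Fin 5, (x0 = 0 ∨ x1 = 4) → (y0 = 0 ∨ y1 = 4) → (z0 = 0 ∨ z1 = 4) →
    qK 3 x0 y0 z0 ≤ qK 3 x1 y0 z0 + qK 3 x0 y1 z0 + qK 3 x0 y0 z1 := by
  decide

/-- **One-point inequality at a petal-completing coordinate, every `k`**: under `x0 = 0 ∨ x1 = ⊤` (three times)
`qK x0 y0 z0 ≤ qK x1 y0 z0 + qK x0 y1 z0 + qK x0 y0 z1` (chart into `Fin 5`: at most one petal per position). [this work] -/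
theorem qcIneqK {k : ℕ} (x0 x1 y0 y1 z0 z1 : Fin (k + 2)) (hx : x0 = 0 ∨ x1 = Fin.last (k + 1)) (hy : y0 = 0 ∨ y1 = Fin.last (k + 1))
    (hz : z0 = 0 ∨ z1 = Fin.last (k + 1)) :
    qK k x0 y0 z0 ≤ qK k x1 y0 z0 + qK k x0 y1 z0 + qK k x0 y0 z1 := by
  set P1 : Fin (k + 2) := if x0 = 0 then x1 else x0 with hP1
  set P2 : Fin (k + 2) := if y0 = 0 then y1 else y0 with hP2
  set c := chart3 k P1 P2 with hc
  have e4 : (4 : Fin 5) = Fin.last (3 + 1) := rfl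
  have T := fun w => e4 ▸ (chart3_eq_four_iff k P1 P2 w).symm
  have Zr := fun w => (chart3_eq_zero_iff k P1 P2 w).symm
  have nx0 : x0 ≠ Fin.last (k + 1) → x0 ≠ 0 → x0 ≠ P1 → False := by
    intro _ h0 hp; apply hp; rw [hP1, if_neg h0]
  have nx1 : x1 ≠ Fin.last (k + 1) → x1 ≠ 0 → x1 ≠ P1 → False := by
    intro ht _ hp; apply hp; rcases hx with h0 | h1
    · rw [hP1, if_pos h0]
    · exact absurd h1 ht
  have ny0 : y0 ≠ Fin.last (k + 1) → y0 ≠ 0 → y0 ≠ P2 → False := by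
    intro _ h0 hp; apply hp; rw [hP2, if_neg h0]
  have ny1 : y1 ≠ Fin.last (k + 1) → y1 ≠ 0 → y1 ≠ P2 → False := by
    intro ht _ hp; apply hp; rcases hy with h0 | h1
    · rw [hP2, if_pos h0]
    · exact absurd h1 ht
  have Exy : ∀ {w w' : Fin (k + 2)}, (w ≠ Fin.last (k + 1) → w ≠ 0 → w ≠ P1 → w ≠ P2 → False) → (w = w' ↔ c w = c w') :=
    fun hw => chart3_eq_iff_petal k P1 P2 (fun a b d g _ _ _ _ => (hw a b d g).elim)
  have hX0 : x0 ≠ Fin.last (k + 1) → x0 ≠ 0 → x0 ≠ P1 → x0 ≠ P2 → False := fun a b d _ => nx0 a b d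
  have hX1 : x1 ≠ Fin.last (k + 1) → x1 ≠ 0 → x1 ≠ P1 → x1 ≠ P2 → False := fun a b d _ => nx1 a b d
  have hY0 : y0 ≠ Fin.last (k + 1) → y0 ≠ 0 → y0 ≠ P1 → y0 ≠ P2 → False := fun a b _ g => ny0 a b g
  have hY1 : y1 ≠ Fin.last (k + 1) → y1 ≠ 0 → y1 ≠ P1 → y1 ≠ P2 → False := fun a b _ g => ny1 a b g
  rw [qK_congr (T x0) (Zr x0) (T y0) (Zr y0) (T z0) (Zr z0) (Exy hX0) (Exy hY0) (Exy hX0),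
    qK_congr (T x1) (Zr x1) (T y0) (Zr y0) (T z0) (Zr z0) (Exy hX1) (Exy hY0) (Exy hX1),
    qK_congr (T x0) (Zr x0) (T y1) (Zr y1) (T z0) (Zr z0) (Exy hX0) (Exy hY1) (Exy hX0),
    qK_congr (T x0) (Zr x0) (T y0) (Zr y0) (T z1) (Zr z1) (Exy hX0) (Exy hY0) (Exy hX0)]
  refine qcIneq5 _ _ _ _ _ _ ?_ ?_ ?_
  · rcases hx with h | h
    · exact Or.inl ((Zr x0).1 h)
    · exact Or.inr (e4 ▸ (T x1).1 h)
  · rcases hy with h | h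
    · exact Or.inl ((Zr y0).1 h)
    · exact Or.inr (e4 ▸ (T y1).1 h)
  · rcases hz with h | h
    · exact Or.inl ((Zr z0).1 h)
    · exact Or.inr (e4 ▸ (T z1).1 h)

/-- Admissible one-point code at a non-bottom singleton / offset, on `Fin 6` (Boolean): `x0 ≤ x1` in `M_4` and the upper label is the
petal `1` or the top. [this work] -/
def usCode (x0 x1 : Fin 6) : Bool := (x0 == x1 || x0 == 0 || x1 == 5) && (x1 == 1 || x1 == 5)

/-- One-point inequality at a non-bottom offset, `Fin 6` codes (`decide`). [this work] -/
theorem usIneq6 : ∀ x0 x1 y0 y1 z0 z1 : Fin 6, usCode x0 x1 = true → usCode y0 y1 = true → usCode z0 z1 = true →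
    qK 4 x0 y0 z0 ≤ qK 4 x1 y0 z0 + qK 4 x0 y1 z0 + qK 4 x0 y0 z1 := by
  decide

/-- From the two propositional conditions to the Boolean code. [this work] -/
theorem usCode_of : ∀ a b : Fin 6, (a = b ∨ a = 0 ∨ b = 5) → (b = 1 ∨ b = 5) → usCode a b = true := by decide

/-- **One-point inequality at a non-bottom offset, every `k`**: if `x0 ≤ x1 ∈ {p, ⊤}` (three times) for one label `p ≠ 0`, then
`qK x0 y0 z0 ≤ qK x1 y0 z0 + qK x0 y1 z0 + qK x0 y0 z1` (chart into `Fin 6`: anchors `p, x0, y0`, one further petal `z0`). [this work] -/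
theorem usIneqK {k : ℕ} (p x0 x1 y0 y1 z0 z1 : Fin (k + 2)) (hp : p ≠ 0)
    (hx : x0 = x1 ∨ x0 = 0 ∨ x1 = Fin.last (k + 1)) (hy : y0 = y1 ∨ y0 = 0 ∨ y1 = Fin.last (k + 1))
    (hz : z0 = z1 ∨ z0 = 0 ∨ z1 = Fin.last (k + 1))
    (hx1 : x1 = p ∨ x1 = Fin.last (k + 1)) (hy1 : y1 = p ∨ y1 = Fin.last (k + 1)) (hz1 : z1 = p ∨ z1 = Fin.last (k + 1)) :
    qK k x0 y0 z0 ≤ qK k x1 y0 z0 + qK k x0 y1 z0 + qK k x0 y0 z1 := by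
  set c := chart4 k p x0 y0 with hc
  have e5 : (5 : Fin 6) = Fin.last (4 + 1) := rfl
  have T := fun w => e5 ▸ (chart4_eq_five_iff k p x0 y0 w).symm
  have Zr := fun w => (chart4_eq_zero_iff k p x0 y0 w).symm
  have nX0 : x0 ≠ Fin.last (k + 1) → x0 ≠ 0 → x0 ≠ p → x0 ≠ x0 → x0 ≠ y0 → False := fun _ _ _ h _ => h rfl
  have nY0 : y0 ≠ Fin.last (k + 1) → y0 ≠ 0 → y0 ≠ p → y0 ≠ x0 → y0 ≠ y0 → False := fun _ _ _ _ h => h rfl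
  have nU : ∀ {u : Fin (k + 2)}, (u = p ∨ u = Fin.last (k + 1)) →
      (u ≠ Fin.last (k + 1) → u ≠ 0 → u ≠ p → u ≠ x0 → u ≠ y0 → False) := by
    intro u hu ht _ hpu _ _
    rcases hu with h | h
    · exact hpu h
    · exact ht h
  have E1 : ∀ {w w' : Fin (k + 2)}, (w ≠ Fin.last (k + 1) → w ≠ 0 → w ≠ p → w ≠ x0 → w ≠ y0 → False) → (w = w' ↔ c w = c w') :=
    fun hw => chart4_eq_iff k p x0 y0 (fun a b d g i _ _ _ _ _ => (hw a b d g i).elim)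
  have E2 : ∀ {w w' : Fin (k + 2)}, (w' ≠ Fin.last (k + 1) → w' ≠ 0 → w' ≠ p → w' ≠ x0 → w' ≠ y0 → False) → (w = w' ↔ c w = c w') :=
    fun hw => chart4_eq_iff k p x0 y0 (fun _ _ _ _ _ a b d g i => (hw a b d g i).elim)
  rw [qK_congr (T x0) (Zr x0) (T y0) (Zr y0) (T z0) (Zr z0) (E1 nX0) (E1 nY0) (E1 nX0),
    qK_congr (T x1) (Zr x1) (T y0) (Zr y0) (T z0) (Zr z0) (E1 (nU hx1)) (E1 nY0) (E1 (nU hx1)),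
    qK_congr (T x0) (Zr x0) (T y1) (Zr y1) (T z0) (Zr z0) (E1 nX0) (E1 (nU hy1)) (E1 nX0),
    qK_congr (T x0) (Zr x0) (T y0) (Zr y0) (T z1) (Zr z1) (E1 nX0) (E2 (nU hz1)) (E1 nX0)]
  have cp : p ≠ Fin.last (k + 1) → c p = 1 := by
    intro h1; show chart4 k p x0 y0 p = 1; unfold chart4; simp [h1, hp]
  have up : ∀ {u : Fin (k + 2)}, (u = p ∨ u = Fin.last (k + 1)) → (c u = 1 ∨ c u = 5) := by
    intro u hu
    rcases hu with h | h
    · by_cases h1 : p = Fin.last (k + 1)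
      · exact Or.inr (e5 ▸ (T u).1 (h.trans h1))
      · exact Or.inl (h ▸ cp h1)
    · exact Or.inr (e5 ▸ (T u).1 h)
  have lo : ∀ {u v : Fin (k + 2)}, (u ≠ Fin.last (k + 1) → u ≠ 0 → u ≠ p → u ≠ x0 → u ≠ y0 → False) →
      (u = v ∨ u = 0 ∨ v = Fin.last (k + 1)) → (c u = c v ∨ c u = 0 ∨ c v = 5) := by
    intro u v hu h
    rcases h with h | h | h
    · exact Or.inl ((E1 hu).1 h)
    · exact Or.inr (Or.inl ((Zr u).1 h))
    · exact Or.inr (Or.inr (e5 ▸ (T v).1 h))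
  have loz : c z0 = c z1 ∨ c z0 = 0 ∨ c z1 = 5 := by
    rcases hz with h | h | h
    · exact Or.inl ((E2 (nU hz1)).1 h)
    · exact Or.inr (Or.inl ((Zr z0).1 h))
    · exact Or.inr (Or.inr (e5 ▸ (T z1).1 h))
  exact usIneq6 _ _ _ _ _ _ (usCode_of _ _ (lo nX0 hx) (up hx1)) (usCode_of _ _ (lo nY0 hy) (up hy1)) (usCode_of _ _ loz (up hz1))

/-! ## The sub-cube functional `QKW` and `QKW ≤ ZKW` -/

variable {α : Type*} [DecidableEq α]

namespace MSunflower

variable {k : ℕ} (F : MSunflower k α)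

/-- The BOTTOM-SPECTATOR FUNCTIONAL of the sub-cube `2^W`: `Σ_{(X,Y,Z) ⊢ W} qK (lab X) (lab Y) (lab Z)`. [this work] -/
def QKW (W : Finset α) : ℤ := nested W fun X Y Z => qK k (F.lab X) (F.lab Y) (F.lab Z)

/-- On the empty cube the functional vanishes. [this work] -/
theorem QKW_empty : F.QKW ∅ = 0 := by
  unfold QKW
  rw [nested_empty]
  exact qK_diag k _

/-- A top-weighted nested `kkK`-sum (weight on the first block) is a nonnegative combination of antipodal Gladkov sums. [this work] -/
theorem nested_topK_kkK_nonneg (W : Finset α) :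
    0 ≤ nested W (fun X S T => topK k (F.lab X) * kkK k (F.lab S) (F.lab T)) := by
  unfold nested
  refine sum_nonneg fun X _ => ?_
  rw [← mul_sum]
  exact mul_nonneg (topK_nonneg _ _) (F.antipodal_gladkov (W \ X))

/-- **`ZKW = QKW + 3` top-spectator Gladkov sums** (the pointwise split `s6K_eq_qK_add_top`, summed). [this work] -/
theorem ZKW_eq_QKW_add (W : Finset α) :
    F.ZKW W = F.QKW W + (nested W (fun X S T => topK k (F.lab X) * kkK k (F.lab S) (F.lab T))
      + nested W (fun X S T => topK k (F.lab S) * kkK k (F.lab X) (F.lab T))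
      + nested W (fun X S T => topK k (F.lab T) * kkK k (F.lab X) (F.lab S))) := by
  unfold ZKW QKW nested
  rw [sum_congr rfl (fun X _ => sum_congr rfl (fun S _ => s6K_eq_qK_add_top k (F.lab X) (F.lab S) (F.lab ((W \ X) \ S))))]
  simp only [sum_add_distrib]

/-- **`QKW ≤ ZKW`** on every sub-cube: the top spectators' Gladkov slack is nonnegative. [this work] -/
theorem QKW_le_ZKW (W : Finset α) : F.QKW W ≤ F.ZKW W := by
  rw [F.ZKW_eq_QKW_add W]
  have h1 := F.nested_topK_kkK_nonneg W
  have h2 : 0 ≤ nested W (fun X S T => topK k (F.lab S) * kkK k (F.lab X) (F.lab T)) := by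
    rw [nested_swap12]; exact F.nested_topK_kkK_nonneg W
  have h3 : 0 ≤ nested W (fun X S T => topK k (F.lab T) * kkK k (F.lab X) (F.lab S)) := by
    rw [nested_swap23, nested_swap12]; exact F.nested_topK_kkK_nonneg W
  linarith

variable [Fintype α]

/-- **Whole-cube spectator form of `Q`**: `QKW univ = 3·SwK [bottom] − NtriK`. [this work] -/
theorem QKW_univ_eq_spec : F.QKW univ = 3 * F.SwK (botK k) - F.NtriK := by
  unfold QKW SwK NtriK
  rw [← sum_parts_eq_nested_univ (g := fun X Y Z => qK k (F.lab X) (F.lab Y) (F.lab Z))]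
  have h2 : ∑ q ∈ parts α, botK k (F.lab q.2) * kkK k (F.lab q.1) (F.lab (q.1 ∪ q.2)ᶜ) =
      ∑ q ∈ parts α, botK k (F.lab q.1) * kkK k (F.lab q.2) (F.lab (q.1 ∪ q.2)ᶜ) :=
    sum_parts_swap12 (fun A B C => botK k (F.lab B) * kkK k (F.lab A) (F.lab C))
  have h3 : ∑ q ∈ parts α, botK k (F.lab (q.1 ∪ q.2)ᶜ) * kkK k (F.lab q.1) (F.lab q.2) =
      ∑ q ∈ parts α, botK k (F.lab q.1) * kkK k (F.lab q.2) (F.lab (q.1 ∪ q.2)ᶜ) := by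
    rw [show (∑ q ∈ parts α, botK k (F.lab (q.1 ∪ q.2)ᶜ) * kkK k (F.lab q.1) (F.lab q.2)) =
        ∑ q ∈ parts α, botK k (F.lab q.1) * kkK k (F.lab (q.1 ∪ q.2)ᶜ) (F.lab q.2) from
      sum_parts_swap13 (fun A B C => botK k (F.lab C) * kkK k (F.lab A) (F.lab B))]
    exact sum_congr rfl fun q _ => by rw [kkK_comm k (F.lab (q.1 ∪ q.2)ᶜ) (F.lab q.2)]
  unfold qK
  rw [sum_sub_distrib, sum_add_distrib, sum_add_distrib, h2, h3]
  ring

/-- **`3·SwK [bottom] − NtriK ≤ ZK`**: the top spectators' slack is nonnegative, so Lemma B (`NtriK ≤ 3·SwK [bottom]`) implies ★ₖ. [this work] -/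
theorem three_SwK_botK_sub_NtriK_le_ZK : 3 * F.SwK (botK k) - F.NtriK ≤ F.ZK := by
  rw [← F.QKW_univ_eq_spec, ← F.ZKW_univ]
  exact F.QKW_le_ZKW univ

/-- ★ₖ from Lemma B: `NtriK ≤ 3·SwK [bottom] ⟹ 0 ≤ ZK`. [this work] -/
theorem ZK_nonneg_of_lemmaB (h : F.NtriK ≤ 3 * F.SwK (botK k)) : 0 ≤ F.ZK := by
  have := F.three_SwK_botK_sub_NtriK_le_ZK
  linarith

end MSunflower

end Summit.CriticalPhenomena.PercolationContinuityZ3.Theorems.SunflowerPartition
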